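import Mathlib
import HarnessLib
import Literature.ModelTheory.FiniteModelTheory.StructCkEquiv
import Summits.ValiantsHypothesis.ValiantsHypothesis.Theorems.SymmetryDialAffinePebble
import Summits.ValiantsHypothesis.ValiantsHypothesis.Theorems.SymmetryDialAffineOrbits
import Summits.ValiantsHypothesis.ValiantsHypothesis.Theorems.SymmetryDialTranslationOrbits
import Summits.ValiantsHypothesis.ValiantsHypothesis.Theorems.SymmetryDialDisalignedCFI
import Summits.ValiantsHypothesis.ValiantsHypothesis.Theorems.SymmetryDialDisalignedCFIDisplacement
import Summits.ValiantsHypothesis.ValiantsHypothesis.Theorems.SymmetryDialDisalignedCFIShear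
import Summits.ValiantsHypothesis.ValiantsHypothesis.Theorems.SymmetryDialShearStrategy
import Summits.ValiantsHypothesis.ValiantsHypothesis.Theorems.SymmetryDialShearInvariant
import Summits.ValiantsHypothesis.ValiantsHypothesis.Theorems.SymmetryDialShearLinear

/-!
# Symmetry dial — the affine-shear lemma (S4) modulo the linear condition (NODE-g9 §B.13, lens 1, g9)

Composition of the game kernels of the lineage (`SymmetryDialShearStrategy`: strategy introduction;
`SymmetryDialShearInvariant`: the latest-pebble clean-protection invariant; `SymmetryDialShearLinear`:
re-clearing = a linear system) into ONE statement with no game, structure or matrix in its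
hypotheses.  `affinePebbleEquiv_of_linear`: for a Good framed Cayley design `D`, any decoration `S`,
SYMMETRIC twists `t, t'` (the matrix entry `(x, y)` reads `t (base x) (base y)`; a shear changes both
orientations of an edge by the same amount, so only symmetric twists can be matched — `cobd_symm`) and
any protection scheme `prot` containing the stars of pinned points, the structures `𝔄(cfiMat D S t)`,
`𝔄(cfiMat D S t')` are `C^k`-equivalent as soon as the LINEAR CONDITION holds: for every position `s`,
lifted pebble `i`, previous latest pebble `i₀` and every SYMMETRIC prescription `d` of edge values the
`𝔽₂`-linear system «`ΔL` additive; `ΔL(base x) + Δc = 0` for the points under pebbles `j ≠ i`;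
`ΔLᵀ(fib ξ) = 0` for the duals under pebbles `j ≠ i`; coboundary change `0` on the protected edges of
`s − i` already protected in `s − i₀`, `= d` on the others» is solvable — the existence form of the
certifier's rank condition `COND_k` (NODE-g9 §B.2) quantified over positions.  (The lemma
`SymmetryDialShearLinear.shearMove_of_linear` asks this for ALL prescriptions, which is never
satisfiable on a symmetric scheme; `shearMove_of_linear_symm` below is the usable form.)  What is left
for the kernel form of (S4): instantiate `prot` with the certifier's protection sets (`hstar`, `hempty`
are then immediate) and discharge the linear condition from the rank certificates.
-/

set_option linter.dupNamespace false

namespace Summit.ValiantsHypothesis.ValiantsHypothesis.Theorems.SymmetryDialShearGame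

open Literature.ModelTheory.FiniteModelTheory
open SymmetryDialAffinePebble (V pair Laff affStr AffinePebbleEquiv)
open SymmetryDialAffineOrbits (add_self)
open SymmetryDialTranslationOrbits (pair_zero_right)
open SymmetryDialDisalignedCFI (base fib Design cfiMat)
open SymmetryDialDisalignedCFIDisplacement (base_append fib_append)
open SymmetryDialDisalignedCFIShear (cobd transp)
open SymmetryDialShearStrategy (ShearParam shearSum)
open SymmetryDialShearInvariant (Pos twistOf blockEq_of_twist_eq cfiMat_eq_of_base_eq cfiMat_eq_of_not_adj
  shearSum_agree_inl shearSum_agree_inr affinePebbleEquiv_of_protScheme)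
open SymmetryDialShearLinear (transp_add twistOf_correct twist_eq_of_entry_eq)

variable {d₀ r δ : ℕ}

/-! ## §1 Symmetry of the coboundary and of the retwist -/

/-- The coboundary of a shear is symmetric in the base pair. -/
theorem cobd_symm (D : Design d₀ r δ) (σ : V d₀ → V r) (v w : V d₀) :
    cobd D σ v w = cobd D σ w v := by
  unfold cobd
  refine Finset.sum_congr rfl fun i _ => ?_
  by_cases h : w = v + D.gen i
  · have h' : v = w + D.gen i := by rw [h, add_assoc, add_self, add_zero]
    rw [if_pos h, if_pos h', add_comm]
  · have h' : ¬ v = w + D.gen i := fun e => h (by rw [e, add_assoc, add_self, add_zero])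
    rw [if_neg h, if_neg h']

/-- The retwist of a symmetric twist is symmetric. -/
theorem twistOf_symm (D : Design d₀ r δ) (t' : V d₀ → V d₀ → Fin 2) (ht' : ∀ v w, t' v w = t' w v)
    (φ : ShearParam d₀ r) (v w : V d₀) : twistOf D t' φ v w = twistOf D t' φ w v := by
  show t' v w + cobd D _ v w = t' w v + cobd D _ w v
  rw [ht', cobd_symm]

/-! ## §2 Re-clearing from the linear condition on symmetric prescriptions -/

/-- **Re-clearing is a linear system (symmetric form).**  As `shearMove_of_linear`, but the linear
condition is asked only for SYMMETRIC prescriptions `d`, and the twists are symmetric. -/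
theorem shearMove_of_linear_symm {k : ℕ} (D : Design d₀ r δ) (hD : D.Good) (S : V d₀ → V r → Bool)
    (t t' : V d₀ → V d₀ → Fin 2) (ht : ∀ v w, t v w = t w v) (ht' : ∀ v w, t' v w = t' w v)
    (prot : Pos k (d₀ + r) → V d₀ → V d₀ → Prop)
    (φ : ShearParam d₀ r) (s : Pos k (d₀ + r)) (i i₀ : Fin k)
    (hclean : ∀ v w, prot (Function.update s i₀ none) v w → ∀ a b : V r,
      cfiMat D S t (Fin.append v a, Fin.append w b) =
        cfiMat D S (twistOf D t' φ) (Fin.append v a, Fin.append w b))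
    (hlin : ∀ d : V d₀ → V d₀ → Fin 2, (∀ v w, d v w = d w v) → ∃ (ΔL : V d₀ → V r) (Δc : V r),
      (∀ v w, ΔL (v + w) = ΔL v + ΔL w) ∧
      (∀ j, j ≠ i → ∀ x, s j = some (.inl x) → ΔL (base x) + Δc = 0) ∧
      (∀ j, j ≠ i → ∀ ξ, s j = some (.inr ξ) → transp ΔL (fib ξ) = 0) ∧
      (∀ (v : V d₀) (idx : Fin δ), prot (Function.update s i none) v (v + D.gen idx) →
        (prot (Function.update s i₀ none) v (v + D.gen idx) →
          cobd D (fun u => ΔL u + Δc) v (v + D.gen idx) = 0) ∧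
        (¬ prot (Function.update s i₀ none) v (v + D.gen idx) →
          cobd D (fun u => ΔL u + Δc) v (v + D.gen idx) = d v (v + D.gen idx)))) :
    ∃ φ' : ShearParam d₀ r,
      (∀ j, j ≠ i → ∀ z, s j = some z → shearSum φ'.1.1 φ'.2 z = shearSum φ.1.1 φ.2 z) ∧
      ∀ v w, prot (Function.update s i none) v w → ∀ a b : V r,
        cfiMat D S t (Fin.append v a, Fin.append w b) =
          cfiMat D S (twistOf D t' φ') (Fin.append v a, Fin.append w b) := by
  classical
  have hsymm : ∀ v w, t v w + twistOf D t' φ v w = t w v + twistOf D t' φ w v := fun v w => by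
    rw [ht, twistOf_symm D t' ht']
  obtain ⟨ΔL, Δc, hadd, hpts, hduals, hedges⟩ := hlin (fun v w => t v w + twistOf D t' φ v w) hsymm
  refine ⟨(⟨fun u => φ.1.1 u + ΔL u, fun a b => by
      show φ.1.1 (a + b) + ΔL (a + b) = (φ.1.1 a + ΔL a) + (φ.1.1 b + ΔL b)
      rw [φ.1.2, hadd, add_add_add_comm]⟩, φ.2 + Δc), ?_, ?_⟩
  · intro j hj z hz
    cases z with
    | inl x =>
      rw [shearSum_agree_inl]
      show (φ.1.1 (base x) + ΔL (base x)) + (φ.2 + Δc) = φ.1.1 (base x) + φ.2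
      rw [add_add_add_comm, hpts j hj x hz, add_zero]
    | inr ξ =>
      rw [shearSum_agree_inr]
      show transp (fun u => φ.1.1 u + ΔL u) (fib ξ) = transp φ.1.1 (fib ξ)
      rw [transp_add, hduals j hj ξ hz, add_zero]
  · intro v w hp a b
    by_cases hvw : v = w
    · subst hvw
      exact cfiMat_eq_of_base_eq D hD.2.2.1 S _ _ _ _ (by rw [base_append, base_append])
    by_cases hadj : ∃ idx, w = v + D.gen idx
    · obtain ⟨idx, rfl⟩ := hadj
      refine blockEq_of_twist_eq D S t _ v _ ?_ a b
      rw [twistOf_correct D t' φ ΔL hadd Δc]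
      obtain ⟨hk, hc⟩ := hedges v idx hp
      by_cases hq : prot (Function.update s i₀ none) v (v + D.gen idx)
      · rw [hk hq, add_zero]
        exact twist_eq_of_entry_eq D hD S t _ v idx (hclean v _ hq 0 0)
      · rw [hc hq]
        generalize t v (v + D.gen idx) = a₁
        generalize twistOf D t' φ v (v + D.gen idx) = b₁
        revert a₁ b₁; decide
    · exact cfiMat_eq_of_not_adj D S _ _ _ _ (by rw [base_append, base_append]; exact hvw)
        (fun idx => by rw [base_append, base_append]; exact fun e => hadj ⟨idx, e⟩)

/-! ## §3 (S4) modulo the linear condition -/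

/-- **(S4) modulo the linear condition.**  `hstar`: both orientations of every base pair with a pinned
end are protected; `h0`: some shear is clean on the protected pairs of the empty board; `hlin`: the
linear re-clearing condition on symmetric prescriptions; twists symmetric. -/
theorem affinePebbleEquiv_of_linear {k : ℕ} (D : Design d₀ r δ) (hD : D.Good)
    (S : V d₀ → V r → Bool) (t t' : V d₀ → V d₀ → Fin 2)
    (ht : ∀ v w, t v w = t w v) (ht' : ∀ v w, t' v w = t' w v)
    (prot : Pos k (d₀ + r) → V d₀ → V d₀ → Prop)
    (hstar : ∀ (s : Pos k (d₀ + r)) (v w : V d₀),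
      (∃ (j : Fin k) (x : V (d₀ + r)), s j = some (.inl x) ∧ base x = v) → prot s v w ∧ prot s w v)
    (h0 : ∃ φ : ShearParam d₀ r, ∀ v w, prot (fun _ => none) v w → ∀ a b : V r,
      cfiMat D S t (Fin.append v a, Fin.append w b) =
        cfiMat D S (twistOf D t' φ) (Fin.append v a, Fin.append w b))
    (hlin : ∀ (s : Pos k (d₀ + r)) (i i₀ : Fin k) (d : V d₀ → V d₀ → Fin 2), (∀ v w, d v w = d w v) →
      ∃ (ΔL : V d₀ → V r) (Δc : V r),
        (∀ v w, ΔL (v + w) = ΔL v + ΔL w) ∧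
        (∀ j, j ≠ i → ∀ x, s j = some (.inl x) → ΔL (base x) + Δc = 0) ∧
        (∀ j, j ≠ i → ∀ ξ, s j = some (.inr ξ) → transp ΔL (fib ξ) = 0) ∧
        (∀ (v : V d₀) (idx : Fin δ), prot (Function.update s i none) v (v + D.gen idx) →
          (prot (Function.update s i₀ none) v (v + D.gen idx) →
            cobd D (fun u => ΔL u + Δc) v (v + D.gen idx) = 0) ∧
          (¬ prot (Function.update s i₀ none) v (v + D.gen idx) →
            cobd D (fun u => ΔL u + Δc) v (v + D.gen idx) = d v (v + D.gen idx)))) :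
    AffinePebbleEquiv k (d₀ + r) (cfiMat D S t) (cfiMat D S t') :=
  affinePebbleEquiv_of_protScheme D hD S t t' prot hstar h0 fun φ s i i₀ hc =>
    shearMove_of_linear_symm D hD S t t' ht ht' prot φ s i i₀ hc (hlin s i i₀)

/-- The zero shear `(L, c) = (0, 0)`. -/
def zeroShear (d₀ r : ℕ) : ShearParam d₀ r :=
  (⟨fun _ => 0, fun _ _ => (add_zero (0 : V r)).symm⟩, 0)

/-- The retwist by the zero shear is the identity: `twistOf D t' 0 = t'`. -/
theorem twistOf_zeroShear (D : Design d₀ r δ) (t' : V d₀ → V d₀ → Fin 2) (v w : V d₀) :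
    twistOf D t' (zeroShear d₀ r) v w = t' v w := by
  show t' v w + cobd D (fun u => (0 : V r) + 0) v w = t' v w
  have hc : cobd D (fun u => (0 : V r) + 0) v w = 0 := by
    unfold cobd
    refine Finset.sum_eq_zero fun i _ => ?_
    split_ifs with h
    · rw [add_zero, pair_zero_right, pair_zero_right, add_zero]
    · rfl
  rw [hc, add_zero]

/-- **(S4) modulo the linear condition, empty-board form.**  When nothing is protected on the empty
board (the certifier's scheme) `h0` is automatic: the game is decided by `hstar`, symmetry of the
twists and the linear condition alone. -/
theorem affinePebbleEquiv_of_linear' {k : ℕ} (D : Design d₀ r δ) (hD : D.Good)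
    (S : V d₀ → V r → Bool) (t t' : V d₀ → V d₀ → Fin 2)
    (ht : ∀ v w, t v w = t w v) (ht' : ∀ v w, t' v w = t' w v)
    (prot : Pos k (d₀ + r) → V d₀ → V d₀ → Prop)
    (hempty : ∀ v w, ¬ prot (fun _ => none) v w)
    (hstar : ∀ (s : Pos k (d₀ + r)) (v w : V d₀),
      (∃ (j : Fin k) (x : V (d₀ + r)), s j = some (.inl x) ∧ base x = v) → prot s v w ∧ prot s w v)
    (hlin : ∀ (s : Pos k (d₀ + r)) (i i₀ : Fin k) (d : V d₀ → V d₀ → Fin 2), (∀ v w, d v w = d w v) →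
      ∃ (ΔL : V d₀ → V r) (Δc : V r),
        (∀ v w, ΔL (v + w) = ΔL v + ΔL w) ∧
        (∀ j, j ≠ i → ∀ x, s j = some (.inl x) → ΔL (base x) + Δc = 0) ∧
        (∀ j, j ≠ i → ∀ ξ, s j = some (.inr ξ) → transp ΔL (fib ξ) = 0) ∧
        (∀ (v : V d₀) (idx : Fin δ), prot (Function.update s i none) v (v + D.gen idx) →
          (prot (Function.update s i₀ none) v (v + D.gen idx) →
            cobd D (fun u => ΔL u + Δc) v (v + D.gen idx) = 0) ∧
          (¬ prot (Function.update s i₀ none) v (v + D.gen idx) →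
            cobd D (fun u => ΔL u + Δc) v (v + D.gen idx) = d v (v + D.gen idx)))) :
    AffinePebbleEquiv k (d₀ + r) (cfiMat D S t) (cfiMat D S t') :=
  affinePebbleEquiv_of_linear D hD S t t' ht ht' prot hstar
    ⟨zeroShear d₀ r, fun v w h => (hempty v w h).elim⟩ hlin

end Summit.ValiantsHypothesis.ValiantsHypothesis.Theorems.SymmetryDialShearGame
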